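import Summits.Ventures.HSemireg.WedgeHankelRecurrenceTschirnhaus
import Summits.Ventures.HSemireg.WedgeHankelRecurrenceDistinctRoots
import Summits.Ventures.HSemireg.WedgeHankelRecurrenceTraceRoots

/-!
# Venture HSemireg — THE NEWTON SUMS OF THE TSCHIRNHAUS TRANSFORM AND THE NUMBER OF DISTINCT VALUES OF `a` ON THE ROOTS. For `m` monic of degree `t + 1`, `a ∈ K[X]` and `T_a = χ(M_a)` (N117):
# **`p_j(T_a) = dualSeq m (a^j · m′) 0`** (the `j`-th Newton sum of the Tschirnhaus transform is the TRACE of `a^j`, over ANY field, root-free in the statement), hence the Hankel matrix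
# `H_t(T_a′/T_a) = (dualSeq m (a^{i+j} m′) 0)_{i,j}` = the Gram matrix `(Tr(a^{i+j}))` of the trace form on the powers of `ā`, and by N110 (characteristic `0`, `φ` a splitting embedding)
# **`rank (Tr(a^{i+j}))_{i,j ≤ t} = #{(φa)(λ) : λ ∈ roots(φ m)}`** — THE NUMBER OF DISTINCT VALUES taken by `a` on the roots of `m`.

HONEST FRAMING. Part of the Lean index of the computation cell `pub-hsemireg` (seat p10 gen 32, Sunday typer «UNIFORM-IN-n»).
LINEAR ALGEBRA OF HANKEL (catalecticant) MATRICES and of polynomials over a field ONLY (`Matrix.charpoly`, `Polynomial.roots`, `Multiset` ∕ `Finset.image`, the lineage's `dualSeq`, `hankelSq`, `mulResidueMat`):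
no variety, no cohomology theory, no sheaf, no Ext group and no semiregularity map is constructed here; nothing here says that HC / HC_CM / HC_AV holds; no Literature fact is declared or used.
Custodian versions as in `WedgeHankelSiegelIdeal` (1/3).

WHAT IS IN THE TREE.  N117 (`WedgeHankelRecurrenceTschirnhaus`): `roots_map_charpoly_mulResidueMat` (`roots(φT_a) = roots(φm).map (φa)`), `splits_map_charpoly_mulResidueMat`, `charpoly_mulResidueMat_natDegree`.
N109 (`WedgeHankelRecurrenceTraceRoots`): `map_dualSeq_mul_derivative_eq_sum_roots` (`φ(dualSeq m (a m′) j) = Σ (φa)(λ) λ^j`).  N107: `map_dualSeq_derivative_eq_sum_roots_pow`.  N110 (`WedgeHankelRecurrenceDistinctRoots`):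
`rank_hankelSq_dualSeq_derivative_eq_card_roots_toFinset_map` (characteristic `0`: `rank H_t(m′/m) = #distinct roots`), `rank_hankelSq_dualSeq_derivative_eq_card_filter_map` (every characteristic).
N103: `trace_mulResidueMat` (`trace M_b = dualSeq m (b m′) 0`).  Mathlib: `Matrix.charpoly_monic`, `Multiset.toFinset_map`, `Finset.card_image_le`.  `rg`: no «number of distinct values on the roots»
statement in the tree or Mathlib.
THIS FILE (namespace `Summit.Ventures.HSemireg.Wedge.HankelOuter` continued; CHAINED on N117 + N110; 0 definitions):
* §693 **`dualSeq_charpoly_mulResidueMat_derivative`** (`p_j(T_a) = dualSeq m (a^j m′) 0`, any field), `mulResidueMat_pow_eq` (`M_{a^j} = M_a^j`), `dualSeq_charpoly_mulResidueMat_derivative_eq_trace` (`= trace (M_a^j)`),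
  `hankelSq_dualSeq_charpoly_mulResidueMat_derivative` (`H_t(T_a′/T_a) = (dualSeq m (a^{i+j} m′) 0)_{i,j}`).
* §694 **`rank_hankelSq_tschirnhaus_eq_card_image`** (characteristic `0`: `rank = #((roots φm).toFinset.image (φa))` = number of distinct values of `a` on the roots), `rank_hankelSq_tschirnhaus_le`
  (`≤ rank H_t(m′/m)`, characteristic `0`: at most the number of distinct roots), `rank_hankelSq_tschirnhaus_X` (`a = X` recovers N110).
Nothing Ext-side.  New names only.
-/

open Module Polynomial
open scoped Matrix Polynomial

namespace Summit.Ventures.HSemireg.Wedge.HankelOuter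

open Summit.Ventures.HSemireg.Wedge Summit.Ventures.HSemireg.Wedge.Hankel

variable (K : Type*) [Field K]

/-! ## §693. The Newton sums of `T_a = χ(M_a)` are the traces of the powers of `a` -/

/-- **`p_j(T_a) = dualSeq m (a^j · m′) 0`**: the `j`-th Newton sum of the Tschirnhaus transform `T_a = χ(M_a)` is the `0`-th value of the symbol `a^j m′/m` — i.e. `Tr(ā^j)` in `K[X]/(m)` (N103) —
for `m` monic of degree `t + 1`, any `a`, over ANY field (proved in the splitting field of `m`: both sides map to `Σ_λ a(λ)^j`). -/
theorem dualSeq_charpoly_mulResidueMat_derivative {t : ℕ} {m : K[X]} (hm : m.Monic) (hmd : m.natDegree = t + 1) (a : K[X]) (j : ℕ) :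
    dualSeq K (mulResidueMat K t m a).charpoly (derivative (mulResidueMat K t m a).charpoly) j = dualSeq K m (a ^ j * derivative m) 0 := by
  classical
  let φ := algebraMap K m.SplittingField
  have hs : (m.map φ).Splits := SplittingField.splits m
  apply φ.injective
  rw [map_dualSeq_derivative_eq_sum_roots_pow K φ (Matrix.charpoly_monic _) (splits_map_charpoly_mulResidueMat K φ hm hmd hs a) j, roots_map_charpoly_mulResidueMat K φ hm hmd hs a,
    map_dualSeq_mul_derivative_eq_sum_roots K φ hm hs (a ^ j) 0, Multiset.map_map]
  refine congrArg _ (Multiset.map_congr rfl fun c _ => ?_)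
  rw [Function.comp_apply, pow_zero, mul_one, Polynomial.map_pow, Polynomial.eval_pow]

/-- `M_{a^j} = M_a ^ j` (`m` monic of degree `t + 1`; N91's multiplicativity iterated). -/
theorem mulResidueMat_pow_eq {t : ℕ} {m : K[X]} (hm : m.Monic) (hmd : m.natDegree = t + 1) (a : K[X]) (j : ℕ) : mulResidueMat K t m (a ^ j) = mulResidueMat K t m a ^ j := by
  induction j with
  | zero => rw [pow_zero, pow_zero, mulResidueMat_one K hm hmd]
  | succ j ih => rw [pow_succ, pow_succ, mulResidueMat_mul K hm hmd, ih]

/-- The same as a trace: `p_j(T_a) = trace (M_a ^ j)` (`m` monic of degree `t + 1`). -/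
theorem dualSeq_charpoly_mulResidueMat_derivative_eq_trace {t : ℕ} {m : K[X]} (hm : m.Monic) (hmd : m.natDegree = t + 1) (a : K[X]) (j : ℕ) :
    dualSeq K (mulResidueMat K t m a).charpoly (derivative (mulResidueMat K t m a).charpoly) j = ((mulResidueMat K t m a) ^ j).trace := by
  rw [dualSeq_charpoly_mulResidueMat_derivative K hm hmd a j, ← trace_mulResidueMat K hm hmd, mulResidueMat_pow_eq K hm hmd]

/-- **`H_t(T_a′/T_a) = (dualSeq m (a^{i+j} m′) 0)_{i,j}` = the Gram matrix `(Tr(ā^{i+j}))` of the trace form of `K[X]/(m)` on `1, ā, …, ā^t`.** -/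
theorem hankelSq_dualSeq_charpoly_mulResidueMat_derivative {t : ℕ} {m : K[X]} (hm : m.Monic) (hmd : m.natDegree = t + 1) (a : K[X]) :
    hankelSq K t (dualSeq K (mulResidueMat K t m a).charpoly (derivative (mulResidueMat K t m a).charpoly)) = Matrix.of fun i j : Fin (t + 1) => dualSeq K m (a ^ ((i : ℕ) + (j : ℕ)) * derivative m) 0 := by
  ext i j
  rw [Matrix.of_apply, ← dualSeq_charpoly_mulResidueMat_derivative K hm hmd a]
  rfl

/-! ## §694. Characteristic `0`: the rank counts the distinct values of `a` on the roots -/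

/-- **THE NUMBER OF DISTINCT VALUES OF `a` ON THE ROOTS OF `m`: in characteristic `0`, `rank (dualSeq m (a^{i+j} m′) 0)_{i,j ≤ t} = #{(φa)(λ) : λ ∈ roots(φ m)}`** for `m` monic of degree `t + 1`
and any splitting embedding `φ` into a field of characteristic `0` (N110's Hermite count applied to the Tschirnhaus transform, whose roots are the `a(λ)`). -/
theorem rank_hankelSq_tschirnhaus_eq_card_image [DecidableEq K] {L : Type*} [Field L] [DecidableEq L] [CharZero L] (φ : K →+* L) {t : ℕ} {m : K[X]} (hm : m.Monic) (hmd : m.natDegree = t + 1)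
    (hs : (m.map φ).Splits) (a : K[X]) :
    (hankelSq K t (dualSeq K (mulResidueMat K t m a).charpoly (derivative (mulResidueMat K t m a).charpoly))).rank = ((m.map φ).roots.toFinset.image fun c => (a.map φ).eval c).card := by
  rw [rank_hankelSq_dualSeq_derivative_eq_card_roots_toFinset_map K φ (Matrix.charpoly_monic _) (charpoly_mulResidueMat_natDegree K t m a) (splits_map_charpoly_mulResidueMat K φ hm hmd hs a),
    roots_map_charpoly_mulResidueMat K φ hm hmd hs a, Multiset.toFinset_map]

/-- Hence in characteristic `0` the Tschirnhaus Hankel rank is AT MOST the number of distinct roots of `m`, i.e. `≤ rank H_t(m′/m)`. -/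
theorem rank_hankelSq_tschirnhaus_le [DecidableEq K] {L : Type*} [Field L] [DecidableEq L] [CharZero L] (φ : K →+* L) {t : ℕ} {m : K[X]} (hm : m.Monic) (hmd : m.natDegree = t + 1)
    (hs : (m.map φ).Splits) (a : K[X]) :
    (hankelSq K t (dualSeq K (mulResidueMat K t m a).charpoly (derivative (mulResidueMat K t m a).charpoly))).rank ≤ (hankelSq K t (dualSeq K m (derivative m))).rank := by
  rw [rank_hankelSq_tschirnhaus_eq_card_image K φ hm hmd hs a, rank_hankelSq_dualSeq_derivative_eq_card_roots_toFinset_map K φ hm hmd hs]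
  exact Finset.card_image_le

/-- Sanity check `a = X`: the Tschirnhaus transform by `X` is `m` itself (N82), and the count is the number of distinct roots (N110). -/
theorem rank_hankelSq_tschirnhaus_X [DecidableEq K] {L : Type*} [Field L] [DecidableEq L] [CharZero L] (φ : K →+* L) {t : ℕ} {m : K[X]} (hm : m.Monic) (hmd : m.natDegree = t + 1)
    (hs : (m.map φ).Splits) :
    (hankelSq K t (dualSeq K (mulResidueMat K t m Polynomial.X).charpoly (derivative (mulResidueMat K t m Polynomial.X).charpoly))).rank = (m.map φ).roots.toFinset.card := by
  rw [charpoly_mulResidueMat_X K hm hmd, rank_hankelSq_dualSeq_derivative_eq_card_roots_toFinset_map K φ hm hmd hs]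

end Summit.Ventures.HSemireg.Wedge.HankelOuter
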